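import Summits.BirchSwinnertonDyer.BirchSwinnertonDyer.Theses.PrintCf2
import Summits.BirchSwinnertonDyer.Rank1Residual.P2.ShuZhaiOneFortyFourSlices
import HarnessLib

/-!
# Route PrintCf2 — aside item `InertShuZhaiOneFortyFourOfFactsPlus` (stmt-BirchSwinnertonDyer-21260) CLOSED

Cell `bsd-print-cf2` (D-0131 (2) PRINT TIER, leaf CornerF @ `p = 2`), seat p4 (the cell's idle by-name
consumer task; the seat's own «2-adic CM Iwasawa road» is booked as beyond-print NO with its named residual,
MEMO-p4-IWASAWA2.md). The aside is the BY-NAME slice of the inert type on the `ℚ`-isogeny classes of the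
explicit Shu–Zhai twists of the SECOND `j = 0` base `144a1 : y² = x³ − 1` (`144a1^{(−pM)} ≅ y² = x³ + (pM)³`,
`p ≡ 23 (mod 24)` prime, `M = ∏Q`, `q ≡ 5 (mod 12)`, `M ≡ 1 (mod 24)`; lit g4 DOSSIER §17): granted the twin
bundle 𝔅_inert⁺ = 𝔅_inert (the eight facts of `InertTwoRankOneOfFacts`, VERBATIM) ∧ Agashe–Ribet–Stein 2006
Thm 2.6 ∧ the TABLE-COMPOSITE base fact `ShuZhai2021.base144a1_optimal_cuspZero` (Cremona Table 1 N = 144 A1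
optimal; Table 4 `L/Ω = 1/2`), every globally minimal CM `W` of analytic rank one with `2` inert that is
`ℚ`-isogenous to a member satisfies `BSD(W,2)`. Proof: destructure the bundle and apply
`P2.cornerFTwo_shuZhaiOneFortyFour_item` (`P2/ShuZhaiOneFortyFourSlices.lean`, seat p4, on ty2 g2's setting
file `P2/ShuZhaiOneFortyFourCurve.lean` and p2 g3's `P2/ShuZhaiCMBaseTransport.lean`), which needs exactly
Cassels (conjunct 3), Shu–Zhai Thm 1.2 (6) and Thm 1.4 (7), row C8 = Burungale–Flach (4), modularity (2),
ARS06 and the base fact; GZK (1), Kriz–Li (5), Thm 4.10 (8) unused (decoration). Currency: LITERAL-by-name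
(hbase, TABLE-COMPOSITE). beyond-print theorem: NO. [cite: ShuZhai2021, Thm. 1.2 and Thm. 1.4]
[cite: Cremona1997, Table 1 (N = 144, curve A1) and Table 4 (row 144 A)] [cite: AgasheRibetStein2006, Thm. 2.6]
[cite: BurungaleFlach2024, Cor. 2] [cite: MilneADT2006, Thm. I.7.3]
-/

-- single-conjunct summit: `Summit.BirchSwinnertonDyer.BirchSwinnertonDyer.…` repeats the name by design
set_option linter.dupNamespace false

namespace Summit.BirchSwinnertonDyer.BirchSwinnertonDyer.Theorems

/-- **Item `InertShuZhaiOneFortyFourOfFactsPlus` (stmt-BirchSwinnertonDyer-21260) holds**: 𝔅_inert⁺ ⟹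
`BSD(W,2)` on the `ℚ`-isogeny classes of the explicit Shu–Zhai twists of `144a1`, by
`P2.cornerFTwo_shuZhaiOneFortyFour_item`. [cite: ShuZhai2021, Thm. 1.2 and Thm. 1.4]
[cite: Cremona1997, Table 1 (N = 144, curve A1) and Table 4 (row 144 A)] [cite: AgasheRibetStein2006, Thm. 2.6]
[cite: BurungaleFlach2024, Cor. 2] [cite: MilneADT2006, Thm. I.7.3] -/
theorem inertShuZhaiOneFortyFourOfFactsPlus_proof :
    Summit.BirchSwinnertonDyer.BirchSwinnertonDyer.Theses.PrintCf2.InertShuZhaiOneFortyFourOfFactsPlus := by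
  unfold Summit.BirchSwinnertonDyer.BirchSwinnertonDyer.Theses.PrintCf2.InertShuZhaiOneFortyFourOfFactsPlus
  rintro ⟨⟨_, hmod, hCas, hCM, _, h12, h14, _⟩, hARS, hbase⟩
  exact Summit.BirchSwinnertonDyer.Rank1Residual.P2.cornerFTwo_shuZhaiOneFortyFour_item hCas h12 h14 hCM hmod
    hARS hbase

end Summit.BirchSwinnertonDyer.BirchSwinnertonDyer.Theorems
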